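import Literature.AlgebraicGeometry.Motives.ProjectiveLineUniformisers
import HarnessLib

/-!
# [OURS · L1 W4.5(b) · LINE (T-j)-PROOF] BRICK S5b, part 1 — the coordinate lemma on `ℙ¹_k`
# («a regular function on `𝔸¹` with a single simple zero is a coordinate»)
# (F-102 `GenusZeroOverCompleteDVR_holds`, res-L1-w45b-lead-2's skeleton `L/res-L1-w45b-lead-2/F102Skeleton.lean` v3 1683bb741349c142,
# brick S5 `exists_morphism_PP`, second half = the special-fibre conjuncts; crux `EquisingularLiftNatThree` stmt-ResolutionOfSingularities-20148)

NOT a statement of any manuscript. Helper file of the chain res-L1-w45b (cell `res-hironaka`, slot W4.5(b)); OURS; AI-written, weaker than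
expert review; `--supports stmt-ResolutionOfSingularities-20148 --as helper` by res-L1-w45b-stub-3 g7 (S5 holder; lead-2 WORD 21:54:15Z).
No `sorry`; standard axioms; no definitions.

WHY. In S5b the morphism `φ : C → ℙ¹_O` of S5a (p575419) is compared with the given `e : C_k ≅ ℙ¹_{k'}` on the special fibre: the
pulled-back chart function `t̄₁ = i^*t₁`, read in `Γ(ℙ¹_{k'}, D₊(x₀)) ≅ k'[T]` through `e`, is a unit exactly on `D₊(x₀) ∩ D₊(x₁)`
(pull-back of S5a's `hb₁`) and generates the maximal ideal at `y₀ = (1:0)` (the section `D₀` meets the fibre in the REDUCED point `z₀`).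
THIS FILE proves that such a section is `c · (x₁/x₀)` with `c ∈ k'ˣ` — so `φ_k` is, chart by chart, a scaling of the coordinate.

WHAT (namespace `…Cruxes.EquisingularLiftNat.F102`).
* `Polynomial.exists_eq_C_mul_X_of_dvd_X_pow` — over a domain: `p ∣ Xⁿ`, `X ∣ p`, `X² ∤ p` ⇒ `p = c·X`, `c` a unit (Mathlib `dvd_prime_pow`).
* `ProjLine.e_eq_frac` — `ProjLine.e x₀ x₁ = Segre.frac 0 1` (bookkeeping between the two tree spellings of `x₁/x₀`).
* `ProjLine.awayι_preimage_basicOpen_awayToSection` — along the chart `Spec (k[x]_{(x₀)})₀ → ℙ¹`, the non-vanishing locus of the section of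
  `b` pulls back to `D(b)`.
* **`ProjLine.exists_eq_cst_mul_sec`** — uniformly in the chart `i : Fin 2` (`j` the other index): for `b ∈ Γ(ℙ¹_k, D₊(xᵢ))` with
  `ℙ¹_b = D₊(xᵢ) ⊓ D₊(x_j)` and `(germ_{yᵢ} b) = 𝔪_{yᵢ}`: `∃ c ≠ 0, b = cst c · (x_j/x_i)`. Proof: `D(b') = D(x₁/x₀)` in `Spec k[T]` gives `T ∣ p ∣ Tⁿ` (radicals, `T` prime); the germ condition
  excludes `T² ∣ p` because `𝔪_{y₀} = (π)` with `π` the germ of `x₁/x₀ ≠ 0` (tree `ProjLine.maximalIdeal_stalk_y`, `algebraMap_germ_sec`,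
  `τ_ne_zero`) and `π ∈ (π² g)` would force `π = 0` in the local ring.

References: W. Fulton, *Intersection Theory* (1998), Example 1.5.1 [cite: Fulton1998]; R. Hartshorne, *Algebraic Geometry* (1977), II §6
(`ℙ¹`, `K(ℙ¹) = k(t)`) [cite: Hartshorne1977]. Tree: `Literature/AlgebraicGeometry/Motives/ProjectiveLineUniformisers.lean` (res of
`ProjLine.y`, `sec`, `ψ'`, `maximalIdeal_stalk_y`, `awayToSection_surjective`), `ProjectiveLineInvolution` (`ProjLine.e`, `res_awayι_awayToSection`),
Mathlib `Proj.awayι_preimage_basicOpen`, `PrimeSpectrum.basicOpen_le_basicOpen_iff`.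
-/

set_option linter.dupNamespace false

noncomputable section

open CategoryTheory AlgebraicGeometry HomogeneousLocalization TopologicalSpace Opposite IsLocalRing
open MvPolynomial (X C)
open Literature.AlgebraicGeometry.Motives Literature.AlgebraicGeometry.Motives.Segre
open Literature.AlgebraicGeometry.Motives.ProjLine

universe u

attribute [local instance] MvPolynomial.gradedAlgebra MvPolynomial.algebraMvPolynomial
  Literature.AlgebraicGeometry.Motives.ProjBaseChange.algebraBase

namespace Summit.ResolutionOfSingularities.ResolutionOfSingularities.Cruxes.EquisingularLiftNat.F102

/-- **A polynomial with a single simple zero at the origin is a coordinate**: over a domain `k`, if `p ∣ Xⁿ`, `X ∣ p` and `X² ∤ p`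
then `p = c · X` for a unit `c`. [folklore] -/
theorem Polynomial.exists_eq_C_mul_X_of_dvd_X_pow {k : Type*} [CommRing k] [IsDomain k] {p : Polynomial k} {n : ℕ}
    (hdvd : p ∣ Polynomial.X ^ n) (hX : Polynomial.X ∣ p) (hX2 : ¬ Polynomial.X ^ 2 ∣ p) :
    ∃ c : k, IsUnit c ∧ p = Polynomial.C c * Polynomial.X := by
  obtain ⟨m, -, u, hu⟩ := (dvd_prime_pow Polynomial.prime_X n).mp hdvd
  have hp : p = Polynomial.X ^ m * ((u⁻¹ : (Polynomial k)ˣ) : Polynomial k) := by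
    rw [← hu, mul_assoc, Units.mul_inv, mul_one]
  have hm1 : m = 1 := by
    rcases Nat.lt_or_ge m 1 with h0 | h1
    · have hm0 : m = 0 := by omega
      subst hm0
      rw [pow_zero, one_mul] at hp
      rw [hp] at hX
      exact absurd (isUnit_of_dvd_unit hX (u⁻¹).isUnit) Polynomial.not_isUnit_X
    · by_contra hne
      have h2 : 2 ≤ m := by omega
      apply hX2
      rw [hp]
      exact (pow_dvd_pow Polynomial.X h2).mul_right _
  subst hm1
  rw [pow_one] at hp
  obtain ⟨c, hc, hcu⟩ := Polynomial.isUnit_iff.mp (u⁻¹).isUnit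
  exact ⟨c, hc, by rw [hp, ← hcu, mul_comm]⟩

/-- `ProjLine.e x₀ x₁ = Segre.frac 0 1` (both are `x₁/x₀`). [folklore] -/
theorem ProjLine.e_eq_frac (k : Type u) [Field k] (i : Fin 2) :
    ProjLine.e k (X i) (X (ProjLine.other i)) (Segre.X_mem k i) (Segre.X_mem k _) = Segre.frac k i (ProjLine.other i) := by
  apply HomogeneousLocalization.val_injective
  rw [ProjLine.e, Away.val_mk, Segre.val_frac]
  simp only [pow_one]

/-- Pulling a section `awayToSection b` over `D₊(x₀)` back along the chart `Spec (k[x]_{(x₀)})₀ → ℙ¹`: its non-vanishing locus is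
`D(b)`. [folklore] -/
theorem ProjLine.awayι_preimage_basicOpen_awayToSection (k : Type u) [Field k] (i : Fin 2) (b : Away (A k) (X i)) :
    Proj.awayι (A k) (X i) (Segre.X_mem k i) zero_lt_one ⁻¹ᵁ (P k).basicOpen (Proj.awayToSection (A k) (X i) b) =
      PrimeSpectrum.basicOpen b := by
  have hj : (⊤ : (Spec (CommRingCat.of (Away (A k) (X i)))).Opens) ≤
      Proj.awayι (A k) (X i) (Segre.X_mem k i) zero_lt_one ⁻¹ᵁ Proj.basicOpen (A k) (X i) := by
    rw [← Proj.opensRange_awayι (A k) (X i) (Segre.X_mem k i) zero_lt_one]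
    exact (Scheme.Hom.preimage_opensRange _).ge
  have h := Scheme.basicOpen_appLE (Proj.awayι (A k) (X i) (Segre.X_mem k i) zero_lt_one) ⊤
    (Proj.basicOpen (A k) (X i)) hj (Proj.awayToSection (A k) (X i) b)
  rw [top_inf_eq] at h
  rw [← h]
  change (Spec (CommRingCat.of (Away (A k) (X i)))).basicOpen
    (GeneratingSections.res (Proj.awayι (A k) (X i) (Segre.X_mem k i) zero_lt_one) (Proj.basicOpen (A k) (X i)) hj
      (Proj.awayToSection (A k) (X i) b)) = _
  rw [res_awayι_awayToSection (A k) (X i) (Segre.X_mem k i) zero_lt_one hj b, basicOpen_eq_of_affine]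

/-- **The coordinate lemma on `ℙ¹_k`.** A section `b` over `D₊(x₀)` which is a unit exactly on `D₊(x₀) ∩ D₊(x₁)` and whose germ at
`(1 : 0)` generates the maximal ideal there is a non-zero constant multiple of the coordinate `x₁/x₀` («a function with a single
simple zero on `𝔸¹` is a coordinate»). [cite: Fulton1998, Example 1.5.1] [folklore] -/
theorem ProjLine.exists_eq_cst_mul_sec (k : Type u) [Field k] (i : Fin 2) (b : Γ(P k, Proj.basicOpen (A k) (X i)))
    (hb : (P k).basicOpen b = Proj.basicOpen (A k) (X i) ⊓ Proj.basicOpen (A k) (X (ProjLine.other i)))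
    (hgen : Ideal.span {(P k).presheaf.germ (Proj.basicOpen (A k) (X i)) (y k i) (y_mem k i) b} =
      maximalIdeal ((P k).presheaf.stalk (y k i))) :
    ∃ c : k, c ≠ 0 ∧ b = Proj.awayToSection (A k) (X i) (Segre.cst k (X i) c) * sec k i := by
  obtain ⟨b', rfl⟩ := awayToSection_surjective k i b
  set p : Polynomial k := ψ' k i b' with hp
  have hb' : b' = (ψ' k i).symm p := by rw [hp, AlgEquiv.symm_apply_apply]
  have hψT : (ψ' k i).symm Polynomial.X = Segre.frac k i (ProjLine.other i) := by
    rw [← ProjLine.e_eq_frac, ← ψ'_e k i, AlgEquiv.symm_apply_apply]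
  -- (a) the unit locus: `D(b') = D(x₁/x₀)` in `Spec (k[x]_{(x₀)})₀`, i.e. `√(p) = √(T)` in `k[T]`
  have hD : PrimeSpectrum.basicOpen b' = PrimeSpectrum.basicOpen (Segre.frac k i (ProjLine.other i)) := by
    rw [← ProjLine.awayι_preimage_basicOpen_awayToSection, hb, Scheme.Hom.preimage_inf,
      Proj.awayι_preimage_basicOpen (A k) (Segre.X_mem k i) zero_lt_one (Segre.X_mem k i) zero_lt_one,
      Proj.awayι_preimage_basicOpen (A k) (Segre.X_mem k i) zero_lt_one (Segre.X_mem k (ProjLine.other i)) zero_lt_one]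
    change PrimeSpectrum.basicOpen (Segre.frac k i i) ⊓ PrimeSpectrum.basicOpen (Segre.frac k i (ProjLine.other i)) = _
    rw [Segre.frac_self, PrimeSpectrum.basicOpen_one, top_inf_eq]
  have hrad₁ : b' ∈ (Ideal.span {Segre.frac k i (ProjLine.other i)}).radical :=
    (PrimeSpectrum.basicOpen_le_basicOpen_iff _ _).mp hD.le
  have hrad₂ : Segre.frac k i (ProjLine.other i) ∈ (Ideal.span {b'}).radical :=
    (PrimeSpectrum.basicOpen_le_basicOpen_iff _ _).mp hD.ge
  have hT : ψ' k i (Segre.frac k i (ProjLine.other i)) = Polynomial.X := by rw [← ProjLine.e_eq_frac, ψ'_e]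
  have hXp : Polynomial.X ∣ p := by
    obtain ⟨n, hn⟩ := hrad₁
    have h := map_dvd (ψ' k i) (Ideal.mem_span_singleton.mp hn)
    rw [hT, map_pow] at h
    exact Polynomial.prime_X.dvd_of_dvd_pow h
  have hpT : ∃ n, p ∣ Polynomial.X ^ n := by
    obtain ⟨n, hn⟩ := hrad₂
    have h := map_dvd (ψ' k i) (Ideal.mem_span_singleton.mp hn)
    rw [map_pow, hT] at h
    exact ⟨n, h⟩
  obtain ⟨n, hpn⟩ := hpT
  -- (b) the germ at `y₀ = (1:0)` generates `𝔪_{y₀} = (π)`, `π` the germ of `x₁/x₀`; so `T² ∤ p`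
  set π := (P k).presheaf.germ (Proj.basicOpen (A k) (X i)) (y k i) (y_mem k i) (sec k i) with hπ
  have hπ0 : π ≠ 0 := by
    intro h0
    have h := algebraMap_germ_sec k i
    rw [← hπ, h0, map_zero] at h
    exact τ_ne_zero k i h.symm
  have hsec : sec k i = Proj.awayToSection (A k) (X i) (Segre.frac k i (ProjLine.other i)) := by
    rw [sec, ProjLine.e_eq_frac]
  have hX2 : ¬ Polynomial.X ^ 2 ∣ p := by
    rintro ⟨r, hr⟩
    -- `b' = (x₁/x₀)² · r'`
    have hb'' : b' = Segre.frac k i (ProjLine.other i) ^ 2 * (ψ' k i).symm r := by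
      rw [hb', hr, map_mul, map_pow, ← hT, AlgEquiv.symm_apply_apply]
    have hgerm : (P k).presheaf.germ (Proj.basicOpen (A k) (X i)) (y k i) (y_mem k i)
        (Proj.awayToSection (A k) (X i) b') =
        π ^ 2 * (P k).presheaf.germ (Proj.basicOpen (A k) (X i)) (y k i) (y_mem k i)
          (Proj.awayToSection (A k) (X i) ((ψ' k i).symm r)) := by
      rw [hb'', map_mul, map_pow, map_mul, map_pow, hπ, hsec]
    -- `π ∈ (π² g)` forces `π = 0`
    have hmem : π ∈ Ideal.span {(P k).presheaf.germ (Proj.basicOpen (A k) (X i)) (y k i) (y_mem k i)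
        (Proj.awayToSection (A k) (X i) b')} := by
      rw [hgen, maximalIdeal_stalk_y k i]; exact Ideal.mem_span_singleton_self _
    rw [hgerm, Ideal.mem_span_singleton] at hmem
    obtain ⟨s, hs⟩ := hmem
    have hπm : π ∈ maximalIdeal _ := by rw [maximalIdeal_stalk_y k i]; exact Ideal.mem_span_singleton_self _
    set g := (P k).presheaf.germ (Proj.basicOpen (A k) (X i)) (y k i) (y_mem k i)
        (Proj.awayToSection (A k) (X i) ((ψ' k i).symm r)) with hg
    have hunit : IsUnit (1 - π * g * s) := by
      refine IsLocalRing.isUnit_one_sub_self_of_mem_nonunits _ ?_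
      rw [← IsLocalRing.mem_maximalIdeal, mul_assoc]
      exact Ideal.mul_mem_right _ _ hπm
    have hzero : π * (1 - π * g * s) = 0 := by
      rw [mul_sub, mul_one, sub_eq_zero]
      calc π = π ^ 2 * g * s := hs
        _ = π * (π * g * s) := by ring
    exact hπ0 ((hunit.mul_left_eq_zero).mp hzero)
  -- so `p = c · T` with `c ≠ 0`
  obtain ⟨c, hc, hpc⟩ := Polynomial.exists_eq_C_mul_X_of_dvd_X_pow hpn hXp hX2
  refine ⟨c, hc.ne_zero, ?_⟩
  have hb2 : b' = Segre.cst k (X i) c * Segre.frac k i (ProjLine.other i) := by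
    rw [hb', hpc, map_mul, ← hT, AlgEquiv.symm_apply_apply, Polynomial.C_eq_algebraMap, AlgEquiv.commutes]
    rfl
  rw [hb2, map_mul, hsec]

end Summit.ResolutionOfSingularities.ResolutionOfSingularities.Cruxes.EquisingularLiftNat.F102

end
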